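import Summits.ResolutionOfSingularities.ResolutionOfSingularities.Theses.FoliationDescent
import Summits.ResolutionOfSingularities.ResolutionOfSingularities.Theorems.LogCanQuotLU.Negative.Transport
import Summits.ResolutionOfSingularities.ResolutionOfSingularities.Theorems.PAlterationPialtHeightOneDerivation
import Literature.AlgebraicGeometry.Resolution.SmoothUniformization
import Literature.AlgebraicGeometry.Resolution.RankOneReduction
import HarnessLib

/-!
# `LogCanQuotLU` — negative lemmas, part I: "`S'` regular at the centre" is LOAD-BEARING —
# without it the crux is relative local uniformization over perfect fields

Support (negative) lemmas for crux `stmt-ResolutionOfSingularities-17082`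
(`Summit.ResolutionOfSingularities.ResolutionOfSingularities.Theses.FoliationDescent.LogCanQuotLU`,
route `FoliationDescent`, crux #3: "log-canonical quotients uniformize" — for `k` perfect of
characteristic `p`, `O` a valuation ring of `K/k`, `S' ≤ O` finitely generated with `Frac S' = K`
and REGULAR AT THE CENTRE, `D ≠ 0` a `p`-closed `k`-derivation of `K`, `g ≠ 0` with `g • D`
preserving the local ring `S'_c` and there NON-SINGULAR or MULTIPLICATIVE, every finitely
generated `R ≤ S'` of `D`-constants is dominated by a finitely generated `A ≤ O ∩ K^D` with
`Frac A = K^D`, regular at the centre), filed by the standing disprover (cdisprove cycle 1; work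
file `Cruxes/LogCanQuotLU/Disproof.lean`). This file declares NO definition: the variant statement
is written out inline (section variable `hW`), and NO declaration concludes the route decl
`LogCanQuotLU` positively.

No hypothesis of the crux is load-bearing for TRUTH (the crux follows from resolution of
singularities: `Cruxes/LogCanQuotLU/Disproof.lean`, `logCanQuotLU_of_resolutionOfSingularities`),
so no `logCanQuotLU_false_without_<H>` theorem can exist short of a counterexample to local
uniformization. What CAN be certified is the converse bookkeeping — which hypotheses keep the crux
from BEING local uniformization:

* `relLU_perfect_of_logCanQuotLU_withoutRegularTop` — drop ONLY "`S'` regular at the centre": the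
  resulting statement implies RELATIVE LOCAL UNIFORMIZATION of every finitely generated extension
  of every perfect field of characteristic `p`, dominating any given finitely generated algebra —
  verbatim the antecedent of the route's `PatchingRelPerfect p` (the route's `FolLU`,
  `DualSandwich`, `TorsorLUPerfect`, `TorsorToLurelPerfect` would all be bypassed). Witness: for
  `R ⊆ O ⊆ K` pick `a ∈ O` not a `p`-th power (if `K` is perfect it is algebraic over `k`, `O = K`
  and there is nothing to do), put `L := K(a^{1/p})`, `D := d/dy` (`y^p = a`; tree
  `exists_derivation_heightOne`: `D y = 1`, `D|_K = 0`, `D^[p] = 0`, `ker D = K`), extend `O` to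
  `L` (Chevalley, `exists_valuationSubring_comap_eq`), and feed the NON-REGULAR model
  `S' := R₁[y]` (`R₁ ⊇ R` an affine model of `K`): `D` maps `S'` into itself and `D y = 1` is a
  unit, so the NON-SINGULAR clause holds with `g = 1`; the conclusion is a regular model of
  `ker D = K` inside `O` dominating `R` (`Negative/Transport.lean`, `exists_model_comap_of_model`).
* `relLocalUniformization_of_logCanQuotLU_withoutRegularTop` — the same in the tree's vocabulary
  (`RelLocalUniformization k K O`, `RankOneReduction.lean`).

Companion: `Negative/WithoutGNeZero.lean` ("`g ≠ 0`" is load-bearing; `D ≠ 0` is idle).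

## Sources
* A. N. Rudakov, I. R. Shafarevich, Inseparable morphisms of algebraic surfaces, Izv. 40 (1976),
  §1 (constants of `p`-closed derivations). [cite: doi:10.1070/im1976v010n06abeh001833]
* J. Novacoski, M. Spivakovsky, Reduction of local uniformization to the rank one case (2014),
  Def. 2.20. [NovacoskiSpivakovsky2014]
-/

noncomputable section

set_option linter.dupNamespace false -- mandated namespace of this single-conjunct summit

open IsLocalRing Polynomial
open Literature.AlgebraicGeometry.Resolution
open Summit.ResolutionOfSingularities.ResolutionOfSingularities.Theorems.Pialt.RadiciallyRegular

namespace Summit.ResolutionOfSingularities.ResolutionOfSingularities.Theorems.LogCanQuotLU.Negative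

/-! ## Drop "`S'` regular at the centre": the crux becomes relative local uniformization -/

section WithoutRegularTop

-- `hW` : `LogCanQuotLU` with the single hypothesis "`S'` is regular at the centre of `O`" deleted
-- (all other binders and hypotheses verbatim).
variable (hW : ∀ p : ℕ, p.Prime → ∀ (k K : Type) [Field k] [CharP k p] [PerfectField k] [Field K]
    [Algebra k K] (O : ValuationSubring K) (S' : Subalgebra k K) (_h' : S'.toSubring ≤ O.toSubring)
    (D : Derivation k K K) (g : K) (R : Subalgebra k K), S'.FG → IsFractionRing S' K →
    D ≠ 0 → (∃ c : K, ∀ x : K, (⇑D)^[p] x = c * D x) → g ≠ 0 →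
    (∀ x : K, (∃ a b : K, a ∈ S' ∧ b ∈ S' ∧ b ≠ 0 ∧ b⁻¹ ∈ O ∧ x = a / b) →
      ∃ a b : K, a ∈ S' ∧ b ∈ S' ∧ b ≠ 0 ∧ b⁻¹ ∈ O ∧ (g • D) x = a / b) →
    ((∃ x : K, (∃ a b : K, a ∈ S' ∧ b ∈ S' ∧ b ≠ 0 ∧ b⁻¹ ∈ O ∧ x = a / b) ∧ (g • D) x ≠ 0 ∧
        ((g • D) x)⁻¹ ∈ O) ∨
      (∃ u : K, (∃ a b : K, a ∈ S' ∧ b ∈ S' ∧ b ≠ 0 ∧ b⁻¹ ∈ O ∧ u = a / b) ∧ u ≠ 0 ∧ u⁻¹ ∈ O ∧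
        ∀ x : K, (⇑(g • D))^[p] x = u * (g • D) x)) →
    R.FG → R ≤ S' → (∀ x ∈ R, D x = 0) →
    ∃ (A : Subalgebra k K) (hA : A.toSubring ≤ O.toSubring), R ≤ A ∧ A.FG ∧ (∀ x ∈ A, D x = 0) ∧
      (∀ x : K, D x = 0 → ∃ a b : K, a ∈ A ∧ b ∈ A ∧ b ≠ 0 ∧ x = a / b) ∧
      IsRegularLocalRing
        (Localization.AtPrime (Ideal.comap (Subring.inclusion hA) (IsLocalRing.maximalIdeal O))))
include hW

/-- **"`S'` regular at the centre" is load-bearing: without it the crux is RELATIVE LOCAL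
UNIFORMIZATION over perfect fields.** If `LogCanQuotLU` held with the regularity hypothesis on
the top `S'` deleted, then for every prime `p`, every perfect field `k` of characteristic `p`,
every finitely generated `K/k`, every valuation ring `O ⊇ k` of `K` and every finitely generated
`R ⊆ O` there would be a finitely generated `A` with `R ⊆ A ⊆ O`, `Frac A = K`, regular at the
centre of `O` — verbatim the antecedent of the route's `PatchingRelPerfect p`. Witness: the
non-regular model `R₁[a^{1/p}]` of `L = K(a^{1/p})` with `D = d/dy`, non-singular since
`D y = 1`. [folklore] -/
theorem relLU_perfect_of_logCanQuotLU_withoutRegularTop (p : ℕ) (hp : p.Prime) :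
    ∀ (k K : Type) [Field k] [CharP k p] [PerfectField k] [Field K] [Algebra k K],
      (⊤ : IntermediateField k K).FG → ∀ O : ValuationSubring K,
      (∀ c : k, algebraMap k K c ∈ O) → ∀ R : Subalgebra k K, R.FG → R.toSubring ≤ O.toSubring →
      ∃ (A : Subalgebra k K) (h : A.toSubring ≤ O.toSubring), R ≤ A ∧ A.FG ∧
        IsFractionRing A K ∧
        IsRegularLocalRing (Localization.AtPrime
          (Ideal.comap (Subring.inclusion h) (IsLocalRing.maximalIdeal O))) := by
  intro k K _ _ _ _ _ hKfg O hOk R hRfg hRO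
  classical
  haveI : Fact p.Prime := ⟨hp⟩
  haveI : CharP K p := charP_of_injective_algebraMap (algebraMap k K).injective p
  -- an affine model `R₁ ⊇ R` of `K` inside `O`
  obtain ⟨A₀, hA₀O, hA₀fg, hA₀fr⟩ := exists_affineModel k K hKfg O hOk
  obtain ⟨tR, htR⟩ := hRfg
  obtain ⟨tA, htA⟩ := hA₀fg
  set G : Finset K := tR ∪ tA with hG
  set R₁ : Subalgebra k K := Algebra.adjoin k (G : Set K) with hR₁
  have hRR₁ : R ≤ R₁ := by
    rw [← htR, hR₁, hG, Finset.coe_union]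
    exact Algebra.adjoin_mono Set.subset_union_left
  have hA₀R₁ : A₀ ≤ R₁ := by
    rw [← htA, hR₁, hG, Finset.coe_union]
    exact Algebra.adjoin_mono Set.subset_union_right
  have hR₁fg : R₁.FG := ⟨G, rfl⟩
  let Oalg : Subalgebra k K := { O.toSubring with algebraMap_mem' := hOk }
  have hR₁O : R₁.toSubring ≤ O.toSubring := by
    change R₁ ≤ Oalg
    rw [hR₁, hG, Finset.coe_union]
    refine Algebra.adjoin_le ?_
    rintro x (hx | hx)
    · exact hRO (htR ▸ Algebra.subset_adjoin hx : x ∈ R)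
    · exact hA₀O (htA ▸ Algebra.subset_adjoin hx : x ∈ A₀)
  have hR₁fr : IsFractionRing R₁ K := isFractionRing_of_le hA₀R₁ hA₀fr
  -- it suffices to dominate `R₁`
  suffices H : ∃ (A : Subalgebra k K) (h : A.toSubring ≤ O.toSubring), R₁ ≤ A ∧ A.FG ∧
      IsFractionRing A K ∧
      IsRegularLocalRing (Localization.AtPrime
        (Ideal.comap (Subring.inclusion h) (IsLocalRing.maximalIdeal O))) by
    obtain ⟨A, h, h1, h2, h3, h4⟩ := H
    exact ⟨A, h, hRR₁.trans h1, h2, h3, h4⟩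
  -- if `K` is perfect, `O = K` and `R₁` itself will do
  by_cases hperf : ∀ a : K, ∃ b : K, b ^ p = a
  · exact exists_regular_of_forall_mem O (forall_mem_of_forall_pow_eq hKfg hperf O hOk)
      R₁ hR₁fg hR₁fr
  obtain ⟨a₀, ha₀'⟩ := not_forall.mp hperf
  have ha₀ : ∀ b : K, b ^ p ≠ a₀ := fun b hb => ha₀' ⟨b, hb⟩
  -- a radicand `a ∈ O` that is not a `p`-th power in `K`
  obtain ⟨a, haO, ha⟩ : ∃ a : K, a ∈ O ∧ ∀ b : K, b ^ p ≠ a := by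
    rcases O.mem_or_inv_mem a₀ with h | h
    · exact ⟨a₀, h, ha₀⟩
    · refine ⟨a₀⁻¹, h, fun b hb => ha₀ b⁻¹ ?_⟩
      rw [inv_pow, hb, inv_inv]
  -- the height-one purely inseparable extension `L = K(a^{1/p})`
  have hirr : Irreducible (X ^ p - C a : K[X]) := X_pow_sub_C_irreducible_of_prime hp ha
  haveI := Fact.mk hirr
  let L : Type := AdjoinRoot (X ^ p - C a : K[X])
  let f : K →ₐ[k] L := IsScalarTower.toAlgHom k K L
  have hf : (f : K →+* L) = algebraMap K L := rfl
  set y : L := AdjoinRoot.root (X ^ p - C a : K[X]) with hy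
  have hyp' : y ^ p = algebraMap K L a := by
    have h := AdjoinRoot.eval₂_root (X ^ p - C a : K[X])
    rw [eval₂_sub, eval₂_X_pow, eval₂_C, sub_eq_zero] at h
    rw [hy, h, AdjoinRoot.algebraMap_eq]
  have hyK : y ∉ (algebraMap K L).range := by
    rintro ⟨c, hc⟩
    apply ha c
    apply (algebraMap K L).injective
    rw [map_pow, hc, hyp']
  have hyp : y ^ p ∈ (algebraMap K L).range := ⟨a, hyp'.symm⟩
  have htop : IntermediateField.adjoin K ({y} : Set L) = ⊤ := by
    apply top_le_iff.mp
    intro z _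
    have hz : z ∈ Algebra.adjoin K ({y} : Set L) := by
      rw [hy, AdjoinRoot.adjoinRoot_eq_top]
      trivial
    exact IntermediateField.algebra_adjoin_le_adjoin K _ hz
  -- a valuation ring of `L` over `O` (Chevalley); replace `O` by its restriction
  obtain ⟨OL, hOL⟩ := exists_valuationSubring_comap_eq (Ω := L) O
  subst hOL
  have hmemO : ∀ x : K, x ∈ OL.comap (algebraMap K L) ↔ algebraMap K L x ∈ OL := fun x => Iff.rfl
  -- the derivation `D = d/dy`: `D y = 1`, `D|_K = 0`, `D^[p] = 0`, `ker D = K`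
  obtain ⟨D, hDy, hDK, hDp, hDker⟩ := exists_derivation_heightOne k y hyK hyp htop
  have hD0 : D ≠ 0 := by
    intro h
    rw [h] at hDy
    exact zero_ne_one hDy
  have hDpc : ∃ c : L, ∀ x : L, (⇑D)^[p] x = c * D x := ⟨0, fun x => by rw [hDp, zero_mul]⟩
  -- the NON-REGULAR model `S' = R₁[y]` of `L` inside `OL`
  set S' : Subalgebra k L := Algebra.adjoin k (insert y (f '' (G : Set K))) with hS'
  have hS'fg : S'.FG := by
    refine ⟨insert y (G.image f), ?_⟩
    rw [Finset.coe_insert, Finset.coe_image, hS']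
  have hyS' : y ∈ S' := Algebra.subset_adjoin (Set.mem_insert _ _)
  have hmapR₁ : R₁.map f ≤ S' := by
    rw [hR₁, AlgHom.map_adjoin, hS']
    exact Algebra.adjoin_mono (Set.subset_insert _ _)
  have hfS' : ∀ x ∈ R₁, f x ∈ S' := fun x hx => hmapR₁ ⟨x, hx, rfl⟩
  have hkOL : ∀ c : k, algebraMap k L c ∈ OL := fun c => by
    rw [IsScalarTower.algebraMap_apply k K L]
    exact (hmemO _).mp (hOk c)
  have hyOL : y ∈ OL := by
    -- valuation rings are root closed: `y ^ p = a ∈ OL`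
    have h : y ^ p ∈ OL := by rw [hyp']; exact (hmemO a).mp haO
    rw [← OL.valuation_le_one_iff] at h ⊢
    rw [map_pow] at h
    by_contra hlt
    exact (one_lt_pow₀ (lt_of_not_ge hlt) hp.ne_zero).not_ge h
  let OLalg : Subalgebra k L := { OL.toSubring with algebraMap_mem' := hkOL }
  have hS'O : S'.toSubring ≤ OL.toSubring := by
    change S' ≤ OLalg
    rw [hS']
    refine Algebra.adjoin_le ?_
    rintro z (rfl | ⟨x, hx, rfl⟩)
    · exact hyOL
    · exact (hmemO x).mp (hR₁O (Algebra.subset_adjoin hx))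
  -- `Frac S' = L`
  have hS'fr : IsFractionRing S' L := by
    refine IsFractionRing.of_field S' L fun z => ?_
    have hcl : z ∈ Subfield.closure (S' : Set L) := by
      have hKcl : ∀ c : K, algebraMap K L c ∈ Subfield.closure (S' : Set L) := by
        intro c
        obtain ⟨u, v, -, huv⟩ := IsFractionRing.div_surjective (A := R₁) c
        rw [← huv, map_div₀]
        exact div_mem (Subfield.subset_closure (hfS' _ u.2))
          (Subfield.subset_closure (hfS' _ v.2))
      let T : Subalgebra K L :=
        { (Subfield.closure (S' : Set L)).toSubring with algebraMap_mem' := hKcl }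
      have hyT : Algebra.adjoin K ({y} : Set L) ≤ T :=
        Algebra.adjoin_le (Set.singleton_subset_iff.mpr (Subfield.subset_closure hyS'))
      have hz : z ∈ IntermediateField.adjoin K ({y} : Set L) := by
        rw [htop]
        exact IntermediateField.mem_top
      obtain ⟨r, hr, s, hs, rfl⟩ := IntermediateField.mem_adjoin_iff_div.mp hz
      exact div_mem (hyT hr) (hyT hs)
    have hcl' : Subring.closure (S' : Set L) = S'.toSubring := Subring.closure_eq S'.toSubring
    obtain ⟨r, hr, s, hs, rfl⟩ := Subfield.mem_closure_iff.mp hcl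
    rw [hcl'] at hr hs
    exact ⟨⟨r, hr⟩, ⟨s, hs⟩, rfl⟩
  -- `D` maps `S'` into itself
  have hDS' : ∀ z ∈ S', D z ∈ S' := by
    intro z hz
    rw [hS'] at hz ⊢
    refine Algebra.adjoin_induction (fun x hx => ?_) (fun r => ?_) (fun u v _ _ hu hv => ?_)
      (fun u v hu' hv' hu hv => ?_) hz
    · rcases hx with rfl | ⟨x, -, rfl⟩
      · rw [hDy]
        exact Subalgebra.one_mem _
      · rw [show f x = algebraMap K L x from rfl, hDK]
        exact Subalgebra.zero_mem _
    · rw [D.map_algebraMap]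
      exact Subalgebra.zero_mem _
    · rw [map_add]
      exact Subalgebra.add_mem _ hu hv
    · rw [D.leibniz, smul_eq_mul, smul_eq_mul]
      exact Subalgebra.add_mem _ (Subalgebra.mul_mem _ hu' hv) (Subalgebra.mul_mem _ hv' hu)
  -- `D` (with `g = 1`) preserves the local ring `S'_c` (quotient rule)
  have hpres : ∀ x : L, (∃ a b : L, a ∈ S' ∧ b ∈ S' ∧ b ≠ 0 ∧ b⁻¹ ∈ OL ∧ x = a / b) →
      ∃ a b : L, a ∈ S' ∧ b ∈ S' ∧ b ≠ 0 ∧ b⁻¹ ∈ OL ∧ ((1 : L) • D) x = a / b := by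
    rintro x ⟨a, b, ha', hb, hb0, hbO, rfl⟩
    refine ⟨b * D a - a * D b, b * b, ?_, S'.mul_mem hb hb, mul_ne_zero hb0 hb0, ?_, ?_⟩
    · exact S'.sub_mem (S'.mul_mem hb (hDS' a ha')) (S'.mul_mem ha' (hDS' b hb))
    · rw [mul_inv]
      exact OL.mul_mem _ _ hbO hbO
    · rw [one_smul, Derivation.leibniz_div, smul_eq_mul, smul_eq_mul, smul_eq_mul, div_eq_mul_inv]
      ring
  -- the NON-SINGULAR clause: `D y = 1` is a unit
  have hcase : (∃ x : L, (∃ a b : L, a ∈ S' ∧ b ∈ S' ∧ b ≠ 0 ∧ b⁻¹ ∈ OL ∧ x = a / b) ∧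
        ((1 : L) • D) x ≠ 0 ∧ (((1 : L) • D) x)⁻¹ ∈ OL) ∨
      (∃ u : L, (∃ a b : L, a ∈ S' ∧ b ∈ S' ∧ b ≠ 0 ∧ b⁻¹ ∈ OL ∧ u = a / b) ∧ u ≠ 0 ∧
        u⁻¹ ∈ OL ∧ ∀ x : L, (⇑((1 : L) • D))^[p] x = u * ((1 : L) • D) x) :=
    Or.inl ⟨y, ⟨y, 1, hyS', S'.one_mem, one_ne_zero, by rw [inv_one]; exact OL.one_mem,
      (div_one y).symm⟩, by rw [one_smul, hDy]; exact one_ne_zero,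
      by rw [one_smul, hDy, inv_one]; exact OL.one_mem⟩
  -- the image of `R₁` consists of constants
  have hR'fg : (R₁.map f).FG := hR₁fg.map f
  have hR'const : ∀ x ∈ R₁.map f, D x = 0 := by
    intro x hx
    obtain ⟨r, -, rfl⟩ := Subalgebra.mem_map.mp hx
    exact hDK r
  -- the crux WITHOUT regularity of `S'` at the centre
  obtain ⟨A, hA, hRA, hAfg, hAconst, hAfrac, hAreg⟩ :=
    hW p hp k L OL S' hS'O D 1 (R₁.map f) hS'fg hS'fr hD0 hDpc one_ne_zero hpres hcase hR'fg
      hmapR₁ hR'const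
  -- `A ⊆ ker D = K`, `K ⊆ Frac A`: transport back to `K`, keeping `R₁`
  obtain ⟨A₁, h₁, h1, h2, h3, h4⟩ := exists_model_comap_of_model f OL A hA
    (fun x hx => by
      obtain ⟨c, hc⟩ := hDker x (hAconst x hx)
      exact ⟨c, hc⟩)
    hAfg
    (fun z => by
      obtain ⟨a', b', ha', hb', hb0, hz⟩ := hAfrac (f z) (hDK z)
      exact ⟨a', b', ha', hb', hb0, hz⟩)
    hAreg R₁ hRA
  exact ⟨A₁, h₁, h1, h2, h3, h4⟩

/-- The same in the tree's vocabulary: **`LogCanQuotLU` without "`S'` regular at the centre"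
implies `RelLocalUniformization k K O`** for every perfect `k` of characteristic `p`, every
finitely generated `K/k` and every valuation ring `O ⊇ k` of `K`.
[cite: NovacoskiSpivakovsky2014, Def. 2.20] -/
theorem relLocalUniformization_of_logCanQuotLU_withoutRegularTop {p : ℕ} (hp : p.Prime)
    (k K : Type) [Field k] [CharP k p] [PerfectField k] [Field K] [Algebra k K]
    (hKfg : (⊤ : IntermediateField k K).FG) (O : ValuationSubring K)
    (hOk : ∀ c : k, algebraMap k K c ∈ O) : RelLocalUniformization k K O := by
  intro R hRfg _ hRO
  obtain ⟨A, h, hRA, hAfg, -, hreg⟩ :=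
    relLU_perfect_of_logCanQuotLU_withoutRegularTop hW p hp k K hKfg O hOk R hRfg hRO
  exact ⟨A, h, hRA, hAfg, hreg⟩

end WithoutRegularTop

end Summit.ResolutionOfSingularities.ResolutionOfSingularities.Theorems.LogCanQuotLU.Negative

end
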